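import Literature.Barriers.HodgeConjecture.MotivatedClassesAbelianVarieties
import Literature.AlgebraicGeometry.Motives.BettiRealizationPure
import Literature.AlgebraicGeometry.Motives.MotivatedCyclesProofs
import Literature.AlgebraicGeometry.Motives.MotivatedCyclesLefschetzProofs
import HarnessLib

/-!
# André's Theorem 0.6.2 as a predicate on the Betti–Hodge datum: the pure-even verdict sharpened, and the sandwich with the `B`-relative Hodge conjecture

`Literature.Barriers.HodgeConjecture.Andre1996_hodgeClassesOnAbelianVarieties_motivated B`
(André 1996, Thm. 0.6.2, "Tout cycle de Hodge sur une variété abélienne est motivé", rendered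
on the abstract Betti–Hodge layer) is a PREDICATE on a Betti–Hodge realization datum
`B : BettiHodgeData ℂ` (`Motives/BettiRealization`: a Weil cohomology `W`, a comparison with
Betti cohomology, and, for each smooth projective `X` and each `i`, SOME pure Hodge structure
`B.hodge hX i`, subject only to (a) pull-backs are morphisms of Hodge structures, (b) each
`B.hodge hX i` is polarizable, (c) cycle classes are Hodge classes). Its statement file
(v2, section "v2") records why no discharge `…_holds : ∀ B, …` is owed: at the pure-even
re-decoration `B.pureEven` of a datum (`Motives/BettiRealizationPure`; Deligne, Hodge II,
2.1.13) the predicate says that EVERY class of every `H²ᵖ(A)` is `B.W`-motivated, and this is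
refuted RELATIVE TO Grothendieck's standard conjecture of Lefschetz type for `B.W` and one
off-diagonal Hodge number (`Andre1996_hodgeClassesOnAbelianVarieties_motivated_not_forall`).

This file adds two things, all proved, no named facts.

1. **The verdict freed of the standard conjecture.** The closure `∀ B', predicate B'` is
   refuted by one datum `B` and one complex abelian variety `A` carrying a class of some
   `H²ᵖ(A)` that is not `B.W`-motivated
   (`Andre1996_hodgeClassesOnAbelianVarieties_motivated_not_forall_of_motivatedClasses_ne_top`,
   through the equivalence `…_pureEven_iff`); and such a class exists as soon as the
   `B.W`-motivated classes of `(A, p)` are `B`-Hodge classes — which for the Betti–Hodge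
   realization is André 1996, §2.5 c), p. 18, verbatim: "Cohomologie de Betti. — […] Tout
   élément de `A_mot(X) ⊆ H_B^{2j}((X ⊗_σ ℂ), ℚ)(j)` est de type `(0,0)` (`ℚ_B(j)` est de type
   `(-j, -j)`)", a THEOREM (the operators `L`, `Λ`, `⋆_L` and algebraic correspondences respect
   the Hodge bigrading), not a conjecture — and `B` sees one non-zero off-diagonal Hodge number
   `h^{p',q'}(B, A) ≠ 0`, `p' ≠ p`, in degree `2p` (classically `h^{2,0}(A) = g(g-1)/2 ≠ 0` for
   `g = dim A ≥ 2`, `p = 1`; Voisin I, §7.1.1): `A_motᵖ(A) = H²ᵖ(A)` would give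
   `Hdgᵖ(B, A) = H²ᵖ(A)`, i.e. purity of type `(p,p)`
   (`HodgeStructure.hodgeNumber_eq_zero_of_hodgeClasses_eq_top`). This is
   `…_not_forall_of_hodgeNumber_ne_zero`; the statement file's `…_not_forall` is its special
   case `A_mot ⊆ ℚ·A ⊆ Hdg` under conjecture `B` for `B.W`
   (`WeilCohomology.motivatedClasses_le_algebraicClasses`,
   `BettiHodgeData.algebraicClasses_le_hodgeClasses`). Contrapositive forms:
   `algebraicClasses_eq_top_of_forall_Andre1996` (a discharge plus `B` for `B.W` would make every
   even Betti group of every complex abelian variety algebraic) and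
   `hodgeNumber_eq_zero_of_forall_Andre1996` (a discharge would make the even cohomology of
   every abelian variety on which motivated classes are Hodge of Hodge–Tate type).
   Both witnesses are classically available and here hypothetical: neither the Betti–Hodge
   realization nor an abelian surface with its Hodge numbers is constructed in the tree.

2. **What the predicate is, for a given datum (the sandwich).** The `B`-relative Hodge
   conjecture for complex abelian varieties implies the predicate as soon as `B.W` has the
   hard Lefschetz property (`…_of_hodgeConjectureFor`: `Hdg = ℚ·A ⊆ A_mot`, algebraic classes
   being motivated, André 1996 §2.1, remark after Déf. 1, the tree's discharge
   `WeilCohomology.algebraicClasses_le_motivatedClasses_holds` — the sense of "ce nouveau pas en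
   direction de la conjecture de Hodge", p. 9); and under the standard conjecture of Lefschetz
   type for `B.W` the predicate is EQUIVALENT to the `B`-relative Hodge conjecture for all
   complex abelian varieties in all codimensions (`…_iff_hodgeConjectureFor`: `⇒` is the
   statement file's `hodgeConjectureFor_abelianVariety_of_lefschetzStandardConjecture`, its
   hypothesis `h03` fed by the tree's discharge
   `motivatedClasses_eq_algebraicClasses_of_lefschetzStandardConjecture_holds`; André 1996, §6.3
   Remarque 2, p. 33, read in both directions).

Deliberately NOT here: a `B`-free rendering of Theorem 0.6.2 (it is a statement about the
Hodge structures OF abelian varieties; the tree has no term for the classical Betti–Hodge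
realization against which it could be stated — the predicate form is the tree's convention,
`Motives/Sweep1`), and the printed proof (§6.3, pp. 31–33: deformation theorem 0.5 via the
theorem of the fixed part; Lemme 6.3.1, compact pencils of abelian varieties cut out of
families of Hodge type whose Baily–Borel boundary has codimension `≥ 2`; Lemme 6.3.2, Hodge
cycles on CM abelian varieties come from Weil cycles; Lemme 6.3.3, Weil cycles deform to a
power of an elliptic curve, where Hodge cycles are algebraic).

## Main statements (all proved)

* `Andre1996_hodgeClassesOnAbelianVarieties_motivated_pureEven_iff`,
  `not_andre1996_hodgeClassesOnAbelianVarieties_motivated_pureEven`,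
  `Andre1996_hodgeClassesOnAbelianVarieties_motivated_not_forall_of_motivatedClasses_ne_top`.
* `motivatedClasses_ne_top_of_hodgeNumber_ne_zero`,
  `Andre1996_hodgeClassesOnAbelianVarieties_motivated_not_forall_of_hodgeNumber_ne_zero`,
  `algebraicClasses_eq_top_of_forall_Andre1996`, `hodgeNumber_eq_zero_of_forall_Andre1996`.
* `Andre1996_hodgeClassesOnAbelianVarieties_motivated_of_hodgeConjectureFor`,
  `Andre1996_hodgeClassesOnAbelianVarieties_motivated_iff_hodgeConjectureFor`.

## References

* Y. André, *Pour une théorie inconditionnelle des motifs*, Publ. Math. IHÉS 83 (1996):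
  Thm. 0.6.2 (p. 9), §2.1 remark following Déf. 1 (p. 14), §2.5 c) and Prop. 2.5.1 (p. 18),
  §6.3 with Remarque 2 (pp. 31–33). [Andre1996Motifs]
* P. Deligne, *The Hodge conjecture* (Clay, 2000), §6: "On abelian varieties, Hodge classes
  […] are "absolutely Hodge" [3], even "motivated" [1]." [Deligne2000]
* P. Deligne, *Théorie de Hodge II*, Publ. Math. IHÉS 40 (1971), 2.1.13. [DeligneHodgeII1971]
* C. Voisin, *Hodge Theory and Complex Algebraic Geometry I* (CUP 2002), §7.1.1, Prop. 11.20.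
  [VoisinHodgeI2002]
-/

noncomputable section

open CategoryTheory AlgebraicGeometry

namespace Literature.Barriers.HodgeConjecture

open Literature.AlgebraicGeometry.Motives

variable (B : BettiHodgeData ℂ)

/-! ### The predicate at the pure-even re-decoration, as an equivalence -/

/-- **At the pure-even re-decoration `B.pureEven` the predicate says that EVERY class is
motivated** — as an equivalence (the statement file's
`Andre1996_hodgeClassesOnAbelianVarieties_motivated.motivatedClasses_eq_top_of_pureEven` is `⇒`):
`Andre1996_hodgeClassesOnAbelianVarieties_motivated B.pureEven` holds iff `A_motᵖ(B.W, A) = H²ᵖ(A)`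
for every complex abelian variety `A` (with smooth-projectivity witness) and every `p`, because
every class of `H²ᵖ(A)` is a Hodge class of `B.pureEven`
(`BettiHodgeData.hodgeClasses_pureEven_two_mul`) while `B.pureEven.W = B.W`.
[cite: DeligneHodgeII1971, 2.1.13] -/
theorem Andre1996_hodgeClassesOnAbelianVarieties_motivated_pureEven_iff :
    Andre1996_hodgeClassesOnAbelianVarieties_motivated B.pureEven ↔
      ∀ (A : AbelianVariety ℂ) (_ : IsSmoothProjective A.dim A.X) (p : ℕ),
        B.W.motivatedClasses A.dim A.X p = ⊤ := by
  unfold Andre1996_hodgeClassesOnAbelianVarieties_motivated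
  refine forall₃_congr fun A hA p ↦ ?_
  rw [B.hodgeClasses_pureEven_two_mul hA p, top_le_iff]
  rfl

/-- **The predicate fails at `B.pureEven` as soon as one complex abelian variety carries a class
that is not `B.W`-motivated** (classically, for the Betti–Hodge realization: the transcendental
part of `H²` of an abelian surface, motivated classes being Hodge classes by André 1996,
§2.5 c)). [cite: Andre1996Motifs, §2.5 c) (p. 18) and Thm. 0.6.2] -/
theorem not_andre1996_hodgeClassesOnAbelianVarieties_motivated_pureEven (A : AbelianVariety ℂ)
    (hA : IsSmoothProjective A.dim A.X) {p : ℕ} (hne : B.W.motivatedClasses A.dim A.X p ≠ ⊤) :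
    ¬ Andre1996_hodgeClassesOnAbelianVarieties_motivated B.pureEven := fun h ↦
  hne ((Andre1996_hodgeClassesOnAbelianVarieties_motivated_pureEven_iff B).1 h A hA p)

/-- **The closure over the datum, refuted by one non-motivated class.** Given one Betti–Hodge
datum `B` and one complex abelian variety `A` with a class in some `H²ᵖ(A)` that is not
`B.W`-motivated, the universal closure `∀ B', Andre1996_hodgeClassesOnAbelianVarieties_motivated B'`
— the only closed form a discharge `…_holds` could take — is false (witness `B.pureEven`). No
standard conjecture enters (compare the statement file's `…_not_forall`). André's Theorem 0.6.2
is a theorem about the Hodge structures OF abelian varieties ("le cas où `K = ℂ`", Betti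
cohomology), not about every datum satisfying (a)–(c). [cite: Andre1996Motifs, Thm. 0.6.2 and §6.3 (p. 31)] -/
theorem Andre1996_hodgeClassesOnAbelianVarieties_motivated_not_forall_of_motivatedClasses_ne_top
    (A : AbelianVariety ℂ) (hA : IsSmoothProjective A.dim A.X) {p : ℕ}
    (hne : B.W.motivatedClasses A.dim A.X p ≠ ⊤) :
    ¬ ∀ B' : BettiHodgeData ℂ, Andre1996_hodgeClassesOnAbelianVarieties_motivated B' := fun h ↦
  not_andre1996_hodgeClassesOnAbelianVarieties_motivated_pureEven B A hA hne (h B.pureEven)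

/-! ### The witness freed of the standard conjecture: motivated classes are Hodge classes -/

/-- **Motivated classes that are Hodge classes cannot exhaust a group with an off-diagonal Hodge
number.** If the `B.W`-motivated classes of `(X, p)` are Hodge classes for `B` — André 1996,
§2.5 c), p. 18, for the Betti–Hodge realization: "Tout élément de `A_mot(X) ⊆ H_B((X ⊗_σ ℂ), ℚ)(j)`
est de type `(0,0)`", i.e. of type `(p,p)` in `H²ᵖ` before the Tate twist — and
`h^{p',q'}(B, X) ≠ 0` for some `p' ≠ p` in degree `2p`, then `A_motᵖ(X) ≠ H²ᵖ(X)`: equality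
would give `Hdgᵖ(B, X) = H²ᵖ(X)`, which forces purity of type `(p,p)`
(`HodgeStructure.hodgeNumber_eq_zero_of_hodgeClasses_eq_top`).
[cite: Andre1996Motifs, §2.5 c) (p. 18)] [cite: VoisinHodgeI2002, §7.1.1] -/
theorem motivatedClasses_ne_top_of_hodgeNumber_ne_zero {n : ℕ} {X : SchemeOver ℂ}
    (hX : IsSmoothProjective n X) {p : ℕ} {p' q' : ℤ} (hne : p' ≠ p)
    (hmot : B.W.motivatedClasses n X p ≤ (B.hodge hX (2 * p)).hodgeClasses p)
    (h : (B.hodge hX (2 * p)).hodgeNumber p' q' ≠ 0) : B.W.motivatedClasses n X p ≠ ⊤ :=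
  fun htop ↦ h ((B.hodge hX (2 * p)).hodgeNumber_eq_zero_of_hodgeClasses_eq_top (p := p)
    (by push_cast; ring) (top_le_iff.1 (htop.ge.trans hmot)) hne)

/-- **Non-dischargeability relative to "motivated classes are Hodge" and one Hodge number.**
Given a datum `B`, a complex abelian variety `A` and a `p` such that the `B.W`-motivated classes
of `(A, p)` are `B`-Hodge classes (André 1996, §2.5 c), a theorem for the Betti–Hodge
realization) and `h^{p',q'}(B, A) ≠ 0` for some `p' ≠ p` in degree `2p` (classically: any
abelian variety of dimension `g ≥ 2`, `p = 1`, `h^{2,0} = g(g-1)/2`), the universal closure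
`∀ B', Andre1996_hodgeClassesOnAbelianVarieties_motivated B'` is false. The statement file's
`Andre1996_hodgeClassesOnAbelianVarieties_motivated_not_forall` is the special case
`A_mot ⊆ ℚ·A ⊆ Hdg` under the standard conjecture of Lefschetz type for `B.W`
(`WeilCohomology.motivatedClasses_le_algebraicClasses` with
`BettiHodgeData.algebraicClasses_le_hodgeClasses`).
[cite: Andre1996Motifs, §2.5 c) (p. 18) and Thm. 0.6.2] [cite: VoisinHodgeI2002, §7.1.1] -/
theorem Andre1996_hodgeClassesOnAbelianVarieties_motivated_not_forall_of_hodgeNumber_ne_zero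
    (A : AbelianVariety ℂ) (hA : IsSmoothProjective A.dim A.X) {p : ℕ} {p' q' : ℤ}
    (hne : p' ≠ p)
    (hmot : B.W.motivatedClasses A.dim A.X p ≤ (B.hodge hA (2 * p)).hodgeClasses p)
    (h : (B.hodge hA (2 * p)).hodgeNumber p' q' ≠ 0) :
    ¬ ∀ B' : BettiHodgeData ℂ, Andre1996_hodgeClassesOnAbelianVarieties_motivated B' :=
  Andre1996_hodgeClassesOnAbelianVarieties_motivated_not_forall_of_motivatedClasses_ne_top B A hA
    (motivatedClasses_ne_top_of_hodgeNumber_ne_zero B hA hne hmot h)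

/-! ### Contrapositive forms: what a discharge would force -/

/-- Were the predicate dischargeable (`∀ B', predicate B'`), then for every datum `B` whose Weil
cohomology satisfies the standard conjecture of Lefschetz type EVERY class of every `H²ᵖ(A)`,
`A` a complex abelian variety, would be a `ℚ`-combination of cycle classes, `ℚ·Aᵖ(A) = H²ᵖ(A)`
(all classes motivated at `B.pureEven`; motivated classes algebraic under `B`, André 1996 §2.1).
[cite: Andre1996Motifs, §2.1 remark following Déf. 1 (p. 14)] -/
theorem algebraicClasses_eq_top_of_forall_Andre1996
    (h : ∀ B' : BettiHodgeData ℂ, Andre1996_hodgeClassesOnAbelianVarieties_motivated B')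
    (hB : B.W.LefschetzStandardConjecture) (A : AbelianVariety ℂ)
    (hA : IsSmoothProjective A.dim A.X) (p : ℕ) : B.W.algebraicClasses A.X p = ⊤ :=
  top_le_iff.1 ((((Andre1996_hodgeClassesOnAbelianVarieties_motivated_pureEven_iff B).1
    (h B.pureEven) A hA p).ge).trans (WeilCohomology.motivatedClasses_le_algebraicClasses hB hA p))

/-- Were the predicate dischargeable (`∀ B', predicate B'`), then every complex abelian variety
`A` whose `B.W`-motivated classes in degree `2p` are `B`-Hodge classes (André 1996, §2.5 c))
would have `H²ᵖ(A)` of pure type `(p,p)` for `B`: all off-diagonal Hodge numbers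
`h^{p',q'}(B, A)`, `p' ≠ p`, vanish — classically absurd (`h^{2,0}(A) = g(g-1)/2`).
[cite: Andre1996Motifs, §2.5 c) (p. 18)] [cite: VoisinHodgeI2002, §7.1.1] -/
theorem hodgeNumber_eq_zero_of_forall_Andre1996
    (h : ∀ B' : BettiHodgeData ℂ, Andre1996_hodgeClassesOnAbelianVarieties_motivated B')
    (A : AbelianVariety ℂ) (hA : IsSmoothProjective A.dim A.X) {p : ℕ} {p' q' : ℤ}
    (hne : p' ≠ p)
    (hmot : B.W.motivatedClasses A.dim A.X p ≤ (B.hodge hA (2 * p)).hodgeClasses p) :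
    (B.hodge hA (2 * p)).hodgeNumber p' q' = 0 := by
  by_contra hh
  exact Andre1996_hodgeClassesOnAbelianVarieties_motivated_not_forall_of_hodgeNumber_ne_zero B A
    hA hne hmot hh h

/-! ### What the predicate is for a given datum: the sandwich with the `B`-relative Hodge conjecture -/

/-- **The predicate follows from the `B`-relative Hodge conjecture for abelian varieties** as
soon as `B.W` has the hard Lefschetz property: `Hdgᵖ(B, A) = ℚ·Aᵖ(A) ⊆ A_motᵖ(A)`, algebraic
classes being motivated (André 1996, §2.1, remark after Déf. 1: "`A_mot(X)_E` contient `A(X)`";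
the tree's discharge `WeilCohomology.algebraicClasses_le_motivatedClasses_holds`). This is the
sense of André's "ce nouveau pas en direction de la conjecture de Hodge" (p. 9).
[cite: Andre1996Motifs, §2.1 remark following Déf. 1 (p. 14) and p. 9] -/
theorem Andre1996_hodgeClassesOnAbelianVarieties_motivated_of_hodgeConjectureFor
    (hL : B.W.HasHardLefschetz)
    (hHC : ∀ (A : AbelianVariety ℂ) (hA : IsSmoothProjective A.dim A.X) (p : ℕ),
      B.HodgeConjectureFor hA p) :
    Andre1996_hodgeClassesOnAbelianVarieties_motivated B := fun A hA p ↦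
  (hHC A hA p).ge.trans (B.W.algebraicClasses_le_motivatedClasses_holds hL hA p)

/-- **Under the standard conjecture of Lefschetz type for `B.W`, the predicate is EQUIVALENT to
the `B`-relative Hodge conjecture for all complex abelian varieties in all codimensions**
(André 1996, §6.3 Remarque 2, p. 33, read in both directions): `⇒` is the statement file's
`hodgeConjectureFor_abelianVariety_of_lefschetzStandardConjecture`, its hypothesis `h03` fed by
the tree's discharge `motivatedClasses_eq_algebraicClasses_of_lefschetzStandardConjecture_holds`;
`⇐` is `Andre1996_hodgeClassesOnAbelianVarieties_motivated_of_hodgeConjectureFor` with hard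
Lefschetz supplied by `B` (`LefschetzStandardConjecture.hasHardLefschetz`).
[cite: Andre1996Motifs, §6.3 Remarque 2 (p. 33)] -/
theorem Andre1996_hodgeClassesOnAbelianVarieties_motivated_iff_hodgeConjectureFor
    (hB : B.W.LefschetzStandardConjecture) :
    Andre1996_hodgeClassesOnAbelianVarieties_motivated B ↔
      ∀ (A : AbelianVariety ℂ) (hA : IsSmoothProjective A.dim A.X) (p : ℕ),
        B.HodgeConjectureFor hA p :=
  ⟨fun h A hA p ↦ hodgeConjectureFor_abelianVariety_of_lefschetzStandardConjecture h
      B.W.motivatedClasses_eq_algebraicClasses_of_lefschetzStandardConjecture_holds hB A hA p,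
    fun h ↦ Andre1996_hodgeClassesOnAbelianVarieties_motivated_of_hodgeConjectureFor B
      hB.hasHardLefschetz h⟩

end Literature.Barriers.HodgeConjecture

end
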